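import Literature.NumberTheory.EllipticCurves.LocalFrobeniusGenerationProofs
import Literature.NumberTheory.EllipticCurves.HasseWeilGoodReductionFrobeniusProofs
import Literature.NumberTheory.GaloisRepresentations.AbsGaloisGroupCompact
import HarnessLib

/-!
# Route `ThetaPartnerAtTwo` (TP2), crux K2R0P♭ (stmt-BirchSwinnertonDyer-26471; derived node K2r0P 24945), line `rankzero` v19,
# stub `stub_poitouTateDeepTwoGen` = (S_PT) — towards brick B5a″ of `Cruxes/SignedMainConjectureCMTwoRankZeroOfPub/PT-DEEP-HALF-DESIGN-w2g4.md`
# §7: **`Γ_{K_v} / I_𝔐` is abelian** — every commutator of `Γ_{K_v}` lies in the inertia group, so every subgroup containing `I_𝔐` is normal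
# (step (L1) of the index computation «every open subgroup of `D_∞ ⊇ I_𝔐` has index prime to `p`»)

HONEST FRAMING (cell `pub/bsd-wall`, W-ALL row 1; width seat `bsd-wall-tp2-p2-w2` g4, `--supports` only). THEOREMS ONLY (no definition, no named
fact, no instance, no `sorry`); tool theorems about the local absolute Galois group in the tree's model (`v.localPrimesAbove`, `Ideal.inertia`,
`IsArithFrobAt`); closes no item; BSD is NOT proved by any of this.

## What is proved (any number field `K`, finite place `v`, prime `𝔐` of the local absolute integers above `𝓂_v`)

* `isClosed_inertia_local` — `I_𝔐 ≤ Γ_{K_v}` is closed (intersection of the closed conditions `g • x − x ∈ 𝔐`, `isClosed_setOf_smul_sub_mem_local`).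
* `commutator_mem_inertia_local` — **`x y x⁻¹ y⁻¹ ∈ I_𝔐` for all `x, y ∈ Γ_{K_v}`**: modulo every open normal subgroup `U`, `x ≡ F^a` and `y ≡ F^b`
  modulo `I_𝔐·U` for an arithmetic Frobenius `F` (`exists_eq_frobenius_pow_mul_inertia_mul`, `exists_isArithFrobAt_localAbsIntegers`), so the
  commutator lies in `I_𝔐·U`; and `⋂_U I_𝔐·U = I_𝔐` because `I_𝔐` is closed in the profinite group `Γ_{K_v}`
  (`ProfiniteGrp.exist_openNormalSubgroup_sub_open_nhds_of_one`). Classically: `Γ_{K_v}/I_𝔐 ≅ Gal(k̄_v/k_v) ≅ Ẑ` is procyclic.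
* `normal_of_inertia_le_local` — every subgroup `H ≥ I_𝔐` of `Γ_{K_v}` is normal.

References: [NeukirchANT1999] Ch. II §9 Prop. (9.9)–(9.11); [SerreLocalFields1979] Ch. I §8; [MilneADT2006] Ch. I §2 (`G/I ≅ Ẑ`).
-/

set_option autoImplicit false
-- the Theorems namespace of this sub repeats the summit name by design (D-0017 nested layout)
set_option linter.dupNamespace false

noncomputable section

open scoped Classical NumberField Pointwise

universe u

namespace Summit.BirchSwinnertonDyer.BirchSwinnertonDyer.Theorems

namespace SignedLowerOffTwo.PTDeep

open NumberField IsDedekindDomain Field IsDedekindDomain.HeightOneSpectrum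
  Literature.NumberTheory.EllipticCurves Literature.NumberTheory.GaloisRepresentations

variable {K : Type u} [Field K] [NumberField K] (v : HeightOneSpectrum (𝓞 K))

/-- **The inertia group `I_𝔐 ≤ Γ_{K_v}` is closed.** [cite: NeukirchANT1999, Ch. II §9 Prop. (9.9)–(9.11)] -/
theorem isClosed_inertia_local (𝔐 : Ideal (localAbsIntegers v)) :
    IsClosed ((𝔐.inertia (absoluteGaloisGroup (v.adicCompletion K)) : Subgroup (absoluteGaloisGroup (v.adicCompletion K))) :
      Set (absoluteGaloisGroup (v.adicCompletion K))) := by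
  have hset : ((𝔐.inertia (absoluteGaloisGroup (v.adicCompletion K)) : Subgroup (absoluteGaloisGroup (v.adicCompletion K))) :
      Set (absoluteGaloisGroup (v.adicCompletion K))) =
      ⋂ x : localAbsIntegers v, {g : absoluteGaloisGroup (v.adicCompletion K) | g • x - x ∈ 𝔐} := by
    ext g
    simp only [SetLike.mem_coe, Set.mem_iInter, Set.mem_setOf_eq]
    rfl
  rw [hset]
  exact isClosed_iInter fun x ↦ isClosed_setOf_smul_sub_mem_local v 𝔐 x

/-- **`Γ_{K_v}/I_𝔐` is abelian: every commutator lies in the inertia group.** See the module docstring for the proof (Frobenius generation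
modulo every open normal subgroup, and `⋂_U I_𝔐·U = I_𝔐`). [cite: NeukirchANT1999, Ch. II §9 Prop. (9.9)–(9.11)] [cite: SerreLocalFields1979, Ch. I §8] -/
theorem commutator_mem_inertia_local {𝔐 : Ideal (localAbsIntegers v)} (h𝔐 : 𝔐 ∈ v.localPrimesAbove)
    (x y : absoluteGaloisGroup (v.adicCompletion K)) :
    x * y * x⁻¹ * y⁻¹ ∈ 𝔐.inertia (absoluteGaloisGroup (v.adicCompletion K)) := by
  -- notation and structure
  haveI : CompactSpace (absoluteGaloisGroup (v.adicCompletion K)) := absoluteGaloisGroup_compactSpace (v.adicCompletion K)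
  haveI : TotallyDisconnectedSpace (absoluteGaloisGroup (v.adicCompletion K)) := by
    change TotallyDisconnectedSpace (AlgebraicClosure (v.adicCompletion K) ≃ₐ[v.adicCompletion K] AlgebraicClosure (v.adicCompletion K))
    infer_instance
  haveI hInormal := inertia_normal_of_mem_localPrimesAbove v h𝔐
  obtain ⟨F, hF⟩ := exists_isArithFrobAt_localAbsIntegers (v := v) h𝔐
  set I : Subgroup (absoluteGaloisGroup (v.adicCompletion K)) := 𝔐.inertia (absoluteGaloisGroup (v.adicCompletion K)) with hIdef
  set c : absoluteGaloisGroup (v.adicCompletion K) := x * y * x⁻¹ * y⁻¹ with hcdef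
  by_contra hc
  -- an open normal subgroup `U` with `c ∉ I·U`: the open set `{g | c * g ∉ I}` contains `1`
  have hO : IsOpen ((fun g : absoluteGaloisGroup (v.adicCompletion K) ↦ c * g) ⁻¹'
      ((I : Set (absoluteGaloisGroup (v.adicCompletion K)))ᶜ)) :=
    (isClosed_inertia_local v 𝔐).isOpen_compl.preimage (continuous_const_mul c)
  have h1O : (1 : absoluteGaloisGroup (v.adicCompletion K)) ∈
      (fun g : absoluteGaloisGroup (v.adicCompletion K) ↦ c * g) ⁻¹' ((I : Set (absoluteGaloisGroup (v.adicCompletion K)))ᶜ) := by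
    simpa only [Set.mem_preimage, mul_one, Set.mem_compl_iff, SetLike.mem_coe] using hc
  obtain ⟨U, hU⟩ := ProfiniteGrp.exist_openNormalSubgroup_sub_open_nhds_of_one hO h1O
  -- `hU : ∀ u ∈ U, c * u ∉ I`
  -- Frobenius coordinates of `x` and `y` modulo `U`
  obtain ⟨a, τ, u, hτ, hu, hx⟩ := exists_eq_frobenius_pow_mul_inertia_mul v h𝔐 hF U.isOpen x
  obtain ⟨b, τ', u', hτ', hu', hy⟩ := exists_eq_frobenius_pow_mul_inertia_mul v h𝔐 hF U.isOpen y
  -- in `Γ / (I ⊔ U)` both are powers of the image of `F`, hence commute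
  let N : Subgroup (absoluteGaloisGroup (v.adicCompletion K)) := I ⊔ (U : Subgroup (absoluteGaloisGroup (v.adicCompletion K)))
  haveI : N.Normal := Subgroup.sup_normal _ _
  have hτN : τ ∈ N := Subgroup.mem_sup_left hτ
  have hτ'N : τ' ∈ N := Subgroup.mem_sup_left hτ'
  have huN : u ∈ N := Subgroup.mem_sup_right hu
  have hu'N : u' ∈ N := Subgroup.mem_sup_right hu'
  have hxN : (QuotientGroup.mk x : absoluteGaloisGroup (v.adicCompletion K) ⧸ N) = (QuotientGroup.mk F) ^ a := by
    rw [hx, QuotientGroup.mk_mul, QuotientGroup.mk_mul, (QuotientGroup.eq_one_iff τ).mpr hτN, (QuotientGroup.eq_one_iff u).mpr huN,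
      mul_one, mul_one, QuotientGroup.mk_pow]
  have hyN : (QuotientGroup.mk y : absoluteGaloisGroup (v.adicCompletion K) ⧸ N) = (QuotientGroup.mk F) ^ b := by
    rw [hy, QuotientGroup.mk_mul, QuotientGroup.mk_mul, (QuotientGroup.eq_one_iff τ').mpr hτ'N, (QuotientGroup.eq_one_iff u').mpr hu'N,
      mul_one, mul_one, QuotientGroup.mk_pow]
  have hcN : c ∈ N := by
    rw [← QuotientGroup.eq_one_iff, hcdef, QuotientGroup.mk_mul, QuotientGroup.mk_mul, QuotientGroup.mk_mul, QuotientGroup.mk_inv,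
      QuotientGroup.mk_inv, hxN, hyN]
    set f : absoluteGaloisGroup (v.adicCompletion K) ⧸ N := QuotientGroup.mk F
    have hcomm : f ^ a * f ^ b = f ^ b * f ^ a := pow_mul_comm f a b
    calc f ^ a * f ^ b * (f ^ a)⁻¹ * (f ^ b)⁻¹ = f ^ b * f ^ a * (f ^ a)⁻¹ * (f ^ b)⁻¹ := by rw [hcomm]
      _ = 1 := by group
  -- `N = I * U`, so `c = i * u₀` and `c * u₀⁻¹ = i ∈ I` with `u₀⁻¹ ∈ U`: contradiction
  have hcN' : c ∈ ((N : Subgroup (absoluteGaloisGroup (v.adicCompletion K))) : Set (absoluteGaloisGroup (v.adicCompletion K))) := hcN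
  rw [Subgroup.normal_mul] at hcN'
  obtain ⟨i, hi, u₀, hu₀, hc'⟩ := Set.mem_mul.mp hcN'
  have hmem : c * u₀⁻¹ ∈ I := by
    rw [← hc', mul_inv_cancel_right]
    exact hi
  exact hU (U.inv_mem hu₀) hmem

/-- **Every subgroup of `Γ_{K_v}` containing the inertia group is normal** (`Γ_{K_v}/I_𝔐` is abelian).
[cite: NeukirchANT1999, Ch. II §9 Prop. (9.9)–(9.11)] -/
theorem normal_of_inertia_le_local {𝔐 : Ideal (localAbsIntegers v)} (h𝔐 : 𝔐 ∈ v.localPrimesAbove)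
    {H : Subgroup (absoluteGaloisGroup (v.adicCompletion K))}
    (hIH : 𝔐.inertia (absoluteGaloisGroup (v.adicCompletion K)) ≤ H) : H.Normal := by
  refine ⟨fun h hh g ↦ ?_⟩
  -- `g h g⁻¹ = (g h g⁻¹ h⁻¹) * h`
  have e : g * h * g⁻¹ = (g * h * g⁻¹ * h⁻¹) * h := by group
  rw [e]
  exact H.mul_mem (hIH (commutator_mem_inertia_local v h𝔐 g h)) hh

end SignedLowerOffTwo.PTDeep

end Summit.BirchSwinnertonDyer.BirchSwinnertonDyer.Theorems

end
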